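import Literature.Analysis.FluidPDE.SawtoothCascadeProfileCurvature
import HarnessLib

/-!
# The shear structure of the cascade carrier on its half-slots
(route `AnomalousDissipation/SawtoothPulseCascade`, line `lip-agmon` of the crux ApproxSol58 =
stmt-AnomalousDissipation-19688; lead g4, module E-concrete, part 1)

On the H half-slot of phase `j` the carrier is `ū(t, x) = rateH j t · U_j(x₁) e₀` (tree
`CascadeParams.field_eq_of_mem_H`, `partialDeriv_field_of_mem_H`); on the V half-slot it is
`rateV j t · U_j(x₀) e₁`. This file records the three structural facts consumed by the shear-nilpotent
growth bounds (`…LipAgmonShearGrowth`, hypotheses `hu0`, `hu1`, `hu2`), with streamwise index `k`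
and cross index `k'` (`(k, k') = (0, 1)` on H slots, `(1, 0)` on V slots):

* `∂ₖū = 0`;
* `|⟪∂ₖ'ū(t, x), w⟫| ≤ rate_j(t) · |wₖ|` (`|U_j′| ≤ 1`, `CascadeParams.abs_deriv_U_le_one`);
* `|⟪∂ₖ'∂ₖ'ū(t, x), w⟫| ≤ rate_j(t) · (2√(2π) N_j/δ_j) · |wₖ|` (`|U_j″| ≤ 2√(2π)N_j/δ_j`,
  `CascadeParams.abs_deriv_deriv_U_le`, p493655).

So along a half pulse the cumulative strain is `Γ = ∫ rate_j = γ` and the curvature budget is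
`Β = γ · 2√(2π) N_j/δ_j`.
-/

set_option linter.dupNamespace false

noncomputable section

namespace Summit.AnomalousDissipation.AnomalousDissipation.Theorems.SawtoothPulseCascade.LipAgmon

open Set MeasureTheory
open scoped InnerProductSpace ContDiff
open Literature.Analysis Literature.Analysis.FunctionSpaces Literature.Analysis.FluidPDE
open Literature.Analysis.FluidPDE.SawtoothCascade
open Literature.Analysis.FluidPDE.SawtoothCascade.CascadeParams

variable (P : CascadeParams)

/-- `⟪c • e_i, w⟫ = c · wᵢ` in `ℝ²`. [folklore] -/
theorem inner_smul_single_left (c : ℝ) (i : Fin 2) (w : EuclideanSpace ℝ (Fin 2)) :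
    ⟪c • EuclideanSpace.single i (1 : ℝ), w⟫_ℝ = c * w i := by
  rw [real_inner_smul_left, EuclideanSpace.inner_single_left]
  simp

/-! ## H half-slots: streamwise `k = 0`, cross `k' = 1` -/

/-- On an H half-slot the carrier does not depend on `x₀`: `∂₀ū = 0`. [cite: ElgindiLissMattingly2025, §1 (u_α = H_α(x₂) e₁ on its half period)] -/
theorem partialDeriv_zero_field_H {j : ℕ} {t : ℝ} (ht : t ∈ Icc (tStart j) (tStart j + tHalf j))
    (x : UnitAddTorus (Fin 2)) : Torus.partialDeriv 0 (P.field t) x = 0 :=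
  (P.partialDeriv_field_of_mem_H ht x).1

/-- On an H half-slot `|⟪∂₁ū(t,x), w⟫| ≤ rateH j t · |w₀|` (`∂₁ū = rateH·U_j′(x₁) e₀`, `|U_j′| ≤ 1`).
[cite: ElgindiLissMattingly2025, §1 (H_α has slope ±1)] -/
theorem abs_inner_partialDeriv_one_field_H (hγ : 0 ≤ P.γ) {j : ℕ} (hδ : 0 < P.δ j) {t : ℝ}
    (ht : t ∈ Icc (tStart j) (tStart j + tHalf j)) (x : UnitAddTorus (Fin 2)) (w : EuclideanSpace ℝ (Fin 2)) :
    |⟪Torus.partialDeriv 1 (P.field t) x, w⟫_ℝ| ≤ P.rateH j t * |w 0| := by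
  rw [(P.partialDeriv_field_of_mem_H ht x).2, inner_smul_single_left, abs_mul, abs_mul,
    abs_of_nonneg (P.rateH_nonneg hγ j t)]
  have h1 := P.abs_deriv_U_le_one hδ (Torus.repr x 1)
  have hr := P.rateH_nonneg hγ j t
  calc P.rateH j t * |deriv (P.U j) (Torus.repr x 1)| * |w 0|
      = P.rateH j t * (|deriv (P.U j) (Torus.repr x 1)| * |w 0|) := by ring
    _ ≤ P.rateH j t * (1 * |w 0|) :=
        mul_le_mul_of_nonneg_left (mul_le_mul_of_nonneg_right h1 (abs_nonneg _)) hr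
    _ = P.rateH j t * |w 0| := by ring

/-- On an H half-slot `∂₁∂₁ū(t, x) = rateH j t · U_j″(x₁) e₀`. [cite: ElgindiLissMattingly2025, §1 (u_α = H_α(x₂) e₁; here mollified)] -/
theorem partialDeriv_one_one_field_H {j : ℕ} (hδ : 0 < P.δ j) {t : ℝ}
    (ht : t ∈ Icc (tStart j) (tStart j + tHalf j)) (x : UnitAddTorus (Fin 2)) :
    Torus.partialDeriv 1 (Torus.partialDeriv 1 (P.field t)) x =
      (P.rateH j t * deriv (deriv (P.U j)) (Torus.repr x 1)) • EuclideanSpace.single 0 (1 : ℝ) := by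
  set Φ : ℝ → EuclideanSpace ℝ (Fin 2) :=
    fun s => (P.rateH j t * deriv (P.U j) s) • EuclideanSpace.single 0 (1 : ℝ) with hΦ
  have h1 : Torus.partialDeriv 1 (P.field t) = fun y => Φ (Torus.repr y 1) :=
    funext fun y => (P.partialDeriv_field_of_mem_H ht y).2
  have hΦper : Function.Periodic Φ 1 := fun s => by
    simp [Φ, P.deriv_U_periodic j s]
  rw [h1, Torus.partialDeriv_coordFun_self hΦper 1 x, hΦ]
  have hd : DifferentiableAt ℝ (fun s => P.rateH j t * deriv (P.U j) s) (Torus.repr x 1) :=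
    (((P.contDiff_U hδ (n := 2)).differentiable_deriv_two).differentiableAt).const_mul _
  rw [deriv_smul_const hd, deriv_const_mul _ ((P.contDiff_U hδ (n := 2)).differentiable_deriv_two _)]

/-- On an H half-slot `|⟪∂₁∂₁ū(t,x), w⟫| ≤ rateH j t · (2√(2π) N_j/δ_j) · |w₀|` (`|U_j″| ≤ 2√(2π)N_j/δ_j`,
tree `CascadeParams.abs_deriv_deriv_U_le`). [cite: ElgindiLissMattingly2025, §1 (H_α; here mollified at scale δ)] -/
theorem abs_inner_partialDeriv_one_one_field_H (hγ : 0 ≤ P.γ) {j : ℕ} (hδ : 0 < P.δ j) {t : ℝ}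
    (ht : t ∈ Icc (tStart j) (tStart j + tHalf j)) (x : UnitAddTorus (Fin 2)) (w : EuclideanSpace ℝ (Fin 2)) :
    |⟪Torus.partialDeriv 1 (Torus.partialDeriv 1 (P.field t)) x, w⟫_ℝ| ≤
      (P.rateH j t * (2 * Real.sqrt (2 * Real.pi) * P.N j / P.δ j)) * |w 0| := by
  rw [partialDeriv_one_one_field_H P hδ ht x, inner_smul_single_left, abs_mul, abs_mul,
    abs_of_nonneg (P.rateH_nonneg hγ j t)]
  have h1 := P.abs_deriv_deriv_U_le hδ (Torus.repr x 1)
  have hr := P.rateH_nonneg hγ j t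
  have h3 : P.rateH j t * |deriv (deriv (P.U j)) (Torus.repr x 1)| ≤
      P.rateH j t * (2 * Real.sqrt (2 * Real.pi) * P.N j / P.δ j) := mul_le_mul_of_nonneg_left h1 hr
  exact mul_le_mul_of_nonneg_right h3 (abs_nonneg _)

/-! ## V half-slots: streamwise `k = 1`, cross `k' = 0` -/

/-- On a V half-slot the carrier does not depend on `x₁`: `∂₁ū = 0`. [cite: ElgindiLissMattingly2025, §1 (u_α = V_α(x₁) e₂ on its half period)] -/
theorem partialDeriv_one_field_V {j : ℕ} {t : ℝ} (ht : t ∈ Icc (tStart j + tHalf j) (tStart (j + 1)))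
    (x : UnitAddTorus (Fin 2)) : Torus.partialDeriv 1 (P.field t) x = 0 :=
  (P.partialDeriv_field_of_mem_V ht x).1

/-- On a V half-slot `|⟪∂₀ū(t,x), w⟫| ≤ rateV j t · |w₁|`. [cite: ElgindiLissMattingly2025, §1 (V_α has slope ±1)] -/
theorem abs_inner_partialDeriv_zero_field_V (hγ : 0 ≤ P.γ) {j : ℕ} (hδ : 0 < P.δ j) {t : ℝ}
    (ht : t ∈ Icc (tStart j + tHalf j) (tStart (j + 1))) (x : UnitAddTorus (Fin 2)) (w : EuclideanSpace ℝ (Fin 2)) :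
    |⟪Torus.partialDeriv 0 (P.field t) x, w⟫_ℝ| ≤ P.rateV j t * |w 1| := by
  rw [(P.partialDeriv_field_of_mem_V ht x).2, inner_smul_single_left, abs_mul, abs_mul,
    abs_of_nonneg (P.rateV_nonneg hγ j t)]
  have h1 := P.abs_deriv_U_le_one hδ (Torus.repr x 0)
  have hr := P.rateV_nonneg hγ j t
  calc P.rateV j t * |deriv (P.U j) (Torus.repr x 0)| * |w 1|
      = P.rateV j t * (|deriv (P.U j) (Torus.repr x 0)| * |w 1|) := by ring
    _ ≤ P.rateV j t * (1 * |w 1|) :=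
        mul_le_mul_of_nonneg_left (mul_le_mul_of_nonneg_right h1 (abs_nonneg _)) hr
    _ = P.rateV j t * |w 1| := by ring

/-- On a V half-slot `∂₀∂₀ū(t, x) = rateV j t · U_j″(x₀) e₁`. [cite: ElgindiLissMattingly2025, §1 (u_α = V_α(x₁) e₂; here mollified)] -/
theorem partialDeriv_zero_zero_field_V {j : ℕ} (hδ : 0 < P.δ j) {t : ℝ}
    (ht : t ∈ Icc (tStart j + tHalf j) (tStart (j + 1))) (x : UnitAddTorus (Fin 2)) :
    Torus.partialDeriv 0 (Torus.partialDeriv 0 (P.field t)) x =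
      (P.rateV j t * deriv (deriv (P.U j)) (Torus.repr x 0)) • EuclideanSpace.single 1 (1 : ℝ) := by
  set Φ : ℝ → EuclideanSpace ℝ (Fin 2) :=
    fun s => (P.rateV j t * deriv (P.U j) s) • EuclideanSpace.single 1 (1 : ℝ) with hΦ
  have h1 : Torus.partialDeriv 0 (P.field t) = fun y => Φ (Torus.repr y 0) :=
    funext fun y => (P.partialDeriv_field_of_mem_V ht y).2
  have hΦper : Function.Periodic Φ 1 := fun s => by
    simp [Φ, P.deriv_U_periodic j s]
  rw [h1, Torus.partialDeriv_coordFun_self hΦper 0 x, hΦ]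
  have hd : DifferentiableAt ℝ (fun s => P.rateV j t * deriv (P.U j) s) (Torus.repr x 0) :=
    (((P.contDiff_U hδ (n := 2)).differentiable_deriv_two).differentiableAt).const_mul _
  rw [deriv_smul_const hd, deriv_const_mul _ ((P.contDiff_U hδ (n := 2)).differentiable_deriv_two _)]

/-- On a V half-slot `|⟪∂₀∂₀ū(t,x), w⟫| ≤ rateV j t · (2√(2π) N_j/δ_j) · |w₁|`. [cite: ElgindiLissMattingly2025, §1 (V_α; here mollified at scale δ)] -/
theorem abs_inner_partialDeriv_zero_zero_field_V (hγ : 0 ≤ P.γ) {j : ℕ} (hδ : 0 < P.δ j) {t : ℝ}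
    (ht : t ∈ Icc (tStart j + tHalf j) (tStart (j + 1))) (x : UnitAddTorus (Fin 2)) (w : EuclideanSpace ℝ (Fin 2)) :
    |⟪Torus.partialDeriv 0 (Torus.partialDeriv 0 (P.field t)) x, w⟫_ℝ| ≤
      (P.rateV j t * (2 * Real.sqrt (2 * Real.pi) * P.N j / P.δ j)) * |w 1| := by
  rw [partialDeriv_zero_zero_field_V P hδ ht x, inner_smul_single_left, abs_mul, abs_mul,
    abs_of_nonneg (P.rateV_nonneg hγ j t)]
  have h1 := P.abs_deriv_deriv_U_le hδ (Torus.repr x 0)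
  have hr := P.rateV_nonneg hγ j t
  have h3 : P.rateV j t * |deriv (deriv (P.U j)) (Torus.repr x 0)| ≤
      P.rateV j t * (2 * Real.sqrt (2 * Real.pi) * P.N j / P.δ j) := mul_le_mul_of_nonneg_left h1 hr
  exact mul_le_mul_of_nonneg_right h3 (abs_nonneg _)

end Summit.AnomalousDissipation.AnomalousDissipation.Theorems.SawtoothPulseCascade.LipAgmon

end
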